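import Literature.AlgebraicGeometry.Frobenioids.PrimaryStepsComplete
import Literature.AlgebraicGeometry.Frobenioids.BiratGerms
import Literature.AlgebraicGeometry.Frobenioids.PreFrobenioidEquivalence
import Literature.AlgebraicGeometry.Frobenioids.PerfFactorialPrimeParts
import HarnessLib

/-!
# [FrdI] Theorem 4.9, proof p. 90 ll. 5–27 — preliminaries for the EXISTENCE of the twin-primary pair of
# Proposition 4.1 (iii) squares (sub-DAG S5, row T49-L07): support bridge, dividing a base-equivalent
# pair by a common divisor, and the cartesian square in recognition form

Mochizuki, *The geometry of Frobenioids I: the general theory*, Kyushu J. Math. **62** (2008)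
293–400, §4, proof of Theorem 4.9, kurims text p. 90 ll. 5–27 [cite: MochizukiFrdI2008, Thm. 4.9 p.90],
with Definition 1.3 (iii)(d) (p. 24), Remark 1.1.1, Definition 2.4 (i)(d) (p. 47) and Proposition 4.1
(iii) (pp. 75–77).

PROOF-ONLY file (seat abc-iut-w5-d021, D-0068 sub-DAG S5 of L1, row `FrdI:Thm4.9/T49-L07`, existence
half — part 1 of 2; part 2 is `Thm49TwinPrimaryExistence.lean`). Contents:
* `IsPerfFactorial.primeFree_pow`, `IsPerfFactorial.exists_mem_carrier_dvd_of_precsim`,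
  `primeFree_of_not_exists_precsim` — the support axiom's reading of "`𝔭 ∈ Supp(a)`" (some primary of
  class `𝔭` is `≼ a`) versus divisibility by an element of the subset `𝔭 ⊆ M` (perfect perf-factorial `M`);
* `PreFrobenioid.div_eq_pull_of_comp_eq` — divisor bookkeeping (Remark 1.1.1; with the tree's `invDiv_iso_comp`);
* `PreFrobenioid.exists_baseEquivalent_of_dvd` — "base-equivalent pre-steps `ζ, γ''` … may, moreover, be
  taken to be co-primary" (p. 90 ll. 19–21): divide a base-equivalent pair by a common divisor of its
  divisors (Def. 1.3 (iii)(d), slice and coslice, + total epimorphicity);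
* `PreFrobenioid.cartesian_of_invDiv_eq_mul` — the cartesian square of Prop. 4.1 (iii) in recognition
  form for a GIVEN apex realising `x_ε + x_ι` (the argument of `exists_coprimary_square`).
No new definitions; nothing here bears on [IUTchIII] Cor. 3.12.
-/

namespace Literature.AlgebraicGeometry.Frobenioids

open CategoryTheory Opposite

universe w v v' u u'

/-! ### Support via `≼` versus support via divisibility (Def. 2.4 (i)(d), perfect perf-factorial `M`) -/

section SuppBridge

variable {M : Type w} [CommMonoid M]

/-- `𝔭`-free elements are closed under powers. [cite: MochizukiFrdI2008, Def. 2.4(i) p.47] -/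
theorem IsPerfFactorial.primeFree_pow (h : IsPerfFactorial M) (hperf : IsPerfect M) (𝔭 : Primes M)
    {x : M} (hx : ∀ q ∈ 𝔭.carrier, ¬ q ∣ x) (n : ℕ) : ∀ q ∈ 𝔭.carrier, ¬ q ∣ x ^ n := by
  induction n with
  | zero =>
    intro q hq hq1
    rw [pow_zero] at hq1
    exact hq.1.1 (h.isDivisorial.isSharp.eq_one_of_isUnit _ (isUnit_of_dvd_one hq1))
  | succ n ih =>
    rw [pow_succ]
    exact h.primeFree_mul hperf 𝔭 ih hx

/-- **Support bridge**: if some primary `a₀` of class `𝔭` satisfies `a₀ ≼ a` (the support axiom's reading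
of "`𝔭 ∈ Supp(a)`", Def. 2.4 (i)(d)), then some element of `𝔭` DIVIDES `a` — namely the `𝔭`-part of `a`
(perfect perf-factorial `M`). [cite: MochizukiFrdI2008, Def. 2.4(i) p.47] -/
theorem IsPerfFactorial.exists_mem_carrier_dvd_of_precsim (h : IsPerfFactorial M) (hperf : IsPerfect M)
    (𝔭 : Primes M) {a a₀ : M} (ha₀ : a₀ ∈ 𝔭.carrier) (hpre : Precsim a₀ a) :
    ∃ q ∈ 𝔭.carrier, q ∣ a := by
  obtain ⟨a₁, a₂, ha, ha₁, ha₂⟩ := h.exists_primePart_split hperf 𝔭 a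
  rcases ha₁ with rfl | ha₁
  · exfalso
    rw [one_mul] at ha
    subst ha
    obtain ⟨n, -, hn⟩ := hpre
    exact h.primeFree_pow hperf 𝔭 ha₂ n a₀ ha₀ hn
  · exact ⟨a₁, ha₁, Dvd.intro _ ha⟩

/-- Conversely (any `M`): an element of `𝔭` dividing `b` is `≼ b`; so "no primary `a₀` of class `𝔭` is
`≼ b`" implies that no element of `𝔭` divides `b`. [cite: MochizukiFrdI2008, Def. 2.4(i) p.47] -/
theorem primeFree_of_not_exists_precsim (𝔭 : Primes M) {b : M}
    (hb : ¬ ∃ (a₀ : M) (h₀ : IsPrimary a₀), Quotient.mk (primarySetoid M) ⟨a₀, h₀⟩ = 𝔭 ∧ Precsim a₀ b) :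
    ∀ q ∈ 𝔭.carrier, ¬ q ∣ b :=
  fun q hq hqb => hb ⟨q, hq.1, hq.2, Precsim.of_dvd hqb⟩

end SuppBridge

namespace PreFrobenioid

variable {D : Type u} [Category.{v} D] {Φ : Dᵒᵖ ⥤ CommMonCat.{w}}
  {C : Type u'} [Category.{v'} C] {F : C ⥤ ElemFrobenioid Φ}

/-! ### Divisor bookkeeping for a factorisation through a pre-step (Remark 1.1.1, Def. 1.3 (iii)(d)) -/

/-- If the pre-step `δ = ζ ∘ g` has `x_δ = m + x_ζ` in `Φ(A)`, then `Div(g) = Φ(δ)(m)`: the zero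
divisor of the first factor is the pull-back of the "quotient" `m`. [cite: MochizukiFrdI2008, Rem. 1.1.1] -/
theorem div_eq_pull_of_comp_eq (hP : IsPreFrobenioid Φ F) {Y C' A : C} {g : Y ⟶ C'} {ζ : C' ⟶ A}
    {δ : Y ⟶ A} (hg : IsPreStep F g) (hζ : IsPreStep F ζ) (hδ : IsPreStep F δ) (hgζ : g ≫ ζ = δ)
    (m : Φ.obj (op (baseObj F A))) (hx : invDiv F δ hδ.2 = m * invDiv F ζ hζ.2) :
    Div F g = pull Φ (Base F δ) m := by
  subst hgζ
  haveI : IsIso (Base F ζ) := hζ.2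
  haveI : IsCancelMul (Φ.obj (op (baseObj F C'))) :=
    isIntegral_iff_isCancelMul.mp (hP.isDivisorial (baseObj F C')).isPreDivisorial.isIntegral
  have h1 : pull Φ (Base F ζ) (invDiv F (g ≫ ζ) hδ.2) = Div F ζ * invDiv F g hg.2 :=
    pull_invDiv_comp F g ζ hg.2 hζ hδ.2
  rw [hx, map_mul, pull_invDiv, mul_comm] at h1
  have h2 : invDiv F g hg.2 = pull Φ (Base F ζ) m := mul_left_cancel h1.symm
  rw [base_comp, pull_comp, ← h2, pull_invDiv]

/-! ### Dividing a base-equivalent pair by a common divisor of its divisors (Def. 1.3 (iii)(d)) -/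

/-- **Dividing out a common part.** For base-equivalent pre-steps `δ₁, δ₂ : Y → A` of a Frobenioid of
isotropic type with `x_{δ₁} = m + s`, `x_{δ₂} = m + t`, there are base-equivalent pre-steps
`ζ, γ'' : C' → A` with `x_ζ = s`, `x_{γ''} = t` — realise `s`, `t` over `A` (Def. 1.3 (iii)(d), slice),
factor `δ₁`, `δ₂` through them; the first factors have the same zero divisor `Φ(δ_i)(m)`, hence differ by an
isomorphism (Def. 1.3 (iii)(d), coslice; total epimorphicity). This is how "base-equivalent pre-steps
`ζ, γ''` … may … be taken to be co-primary" (p. 90 ll. 19–21). [cite: MochizukiFrdI2008, Thm. 4.9 p.90] -/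
theorem exists_baseEquivalent_of_dvd (hF : IsFrobenioid F) (histr : IsOfIsotropicType F) {Y A : C}
    {δ₁ δ₂ : Y ⟶ A} (h₁ : IsPreStep F δ₁) (h₂ : IsPreStep F δ₂) (hb : BaseEquivalent F δ₁ δ₂)
    (m s t : Φ.obj (op (baseObj F A))) (hs : invDiv F δ₁ h₁.2 = m * s) (ht : invDiv F δ₂ h₂.2 = m * t) :
    ∃ (C' : C) (ζ γ'' : C' ⟶ A) (hζ : IsPreStep F ζ) (hγ'' : IsPreStep F γ''),
      BaseEquivalent F ζ γ'' ∧ invDiv F ζ hζ.2 = s ∧ invDiv F γ'' hγ''.2 = t := by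
  have hP := hF.isPreFrobenioid
  have hco : ∀ {X Z : C} {f : X ⟶ Z}, IsPreStep F f → IsCoAngularPreStep F f :=
    fun h => isCoAngularPreStep_of_isotropic histr h
  -- realise `s` and `t` over `A`, and factor `δ₁`, `δ₂`
  obtain ⟨C', ζ, hζco, hζs⟩ := hF.iii_d_over_surj A s
  obtain ⟨C₀, γ₀, hγ₀co, hγ₀t⟩ := hF.iii_d_over_surj A t
  obtain ⟨g, hgco, hg⟩ := hF.iii_d_over_full δ₁ ζ (hco h₁) hζco (by rw [hζs, hs]; exact Dvd.intro_left m rfl)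
  obtain ⟨g₀, hg₀co, hg₀⟩ := hF.iii_d_over_full δ₂ γ₀ (hco h₂) hγ₀co
    (by rw [hγ₀t, ht]; exact Dvd.intro_left m rfl)
  -- the first factors have the same zero divisor
  have hDg : Div F g = pull Φ (Base F δ₁) m :=
    div_eq_pull_of_comp_eq hP hgco.2 hζco.2 h₁ hg m (by rw [hs, hζs, mul_comm])
  have hDg₀ : Div F g₀ = pull Φ (Base F δ₁) m := by
    rw [show Base F δ₁ = Base F δ₂ from hb]
    exact div_eq_pull_of_comp_eq hP hg₀co.2 hγ₀co.2 h₂ hg₀ m (by rw [ht, hγ₀t, mul_comm])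
  -- hence differ by an isomorphism `f : C' ≅ C₀` under `Y`
  obtain ⟨f, hfco, hf⟩ := hF.iii_d_under_full g g₀ hgco hg₀co (by rw [hDg, hDg₀])
  obtain ⟨f', -, hf'⟩ := hF.iii_d_under_full g₀ g hg₀co hgco (by rw [hDg, hDg₀])
  haveI := hP.isTotallyEpimorphic.epi g
  haveI := hP.isTotallyEpimorphic.epi g₀
  have hff' : f ≫ f' = 𝟙 C' := by
    apply (cancel_epi g).mp
    rw [← Category.assoc, hf, hf', Category.comp_id]
  have hf'f : f' ≫ f = 𝟙 C₀ := by
    apply (cancel_epi g₀).mp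
    rw [← Category.assoc, hf', hf, Category.comp_id]
  haveI : IsIso f := ⟨⟨f', hff', hf'f⟩⟩
  have hfγ₀ : IsPreStep F (f ≫ γ₀) := IsPreStep.comp F hfco.2 hγ₀co.2
  refine ⟨C', ζ, f ≫ γ₀, hζco.2, hfγ₀, ?_, hζs, ?_⟩
  · -- base-equivalence: `Base(g) ≫ Base(ζ) = Base(δ₁) = Base(δ₂) = Base(g) ≫ Base(f ≫ γ₀)`
    haveI : IsIso (Base F g) := hgco.2.2
    apply (cancel_epi (Base F g)).mp
    show Base F g ≫ Base F ζ = Base F g ≫ Base F (f ≫ γ₀)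
    rw [← base_comp, hg, show Base F δ₁ = Base F δ₂ from hb, ← hg₀, ← hf, Category.assoc, base_comp]
  · rw [invDiv_iso_comp hP f γ₀ hγ₀co.2.2 hfγ₀.2, hγ₀t]

/-! ### Cartesian squares among pre-steps from the realisation of `x_ε + x_ι` (Prop. 4.1 (iii)) -/

/-- **The cartesian square of Proposition 4.1 (iii), recognition form** (the argument of
`exists_coprimary_square`, FrdI pp. 76–77): if `x_ε + x_ι ≤ x_U` whenever `x_ε, x_ι ≤ x_U` (e.g. `ε`, `ι`
co-primary, `Φ` perf-factorial), then ANY pre-step `υ : U → F'` with `x_υ = x_ε + x_ι` and factorisations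
`υ = ε ∘ ε' = ι ∘ ι'` through pre-steps presents a square `ε ∘ ε' = ι ∘ ι'` that is cartesian in the
category of pre-steps. [cite: MochizukiFrdI2008, Prop. 4.1 (iii) p.75] -/
theorem cartesian_of_invDiv_eq_mul (hF : IsFrobenioid F) (histr : IsOfIsotropicType F)
    {E I F' U : C} {ε : E ⟶ F'} {ι : I ⟶ F'} (hε : IsPreStep F ε) (hι : IsPreStep F ι)
    (hsum : ∀ c : Φ.obj (op (baseObj F F')),
      invDiv F ε hε.2 ∣ c → invDiv F ι hι.2 ∣ c → invDiv F ε hε.2 * invDiv F ι hι.2 ∣ c)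
    {υ : U ⟶ F'} (hυ : IsPreStep F υ) (hx : invDiv F υ hυ.2 = invDiv F ε hε.2 * invDiv F ι hι.2)
    {ε' : U ⟶ E} {ι' : U ⟶ I} (hε' : IsPreStep F ε') (hε'e : ε' ≫ ε = υ) (hι'e : ι' ≫ ι = υ) :
    ∀ ⦃V : C⦄ (a : V ⟶ E) (b : V ⟶ I), IsPreStep F a → IsPreStep F b → a ≫ ε = b ≫ ι →
      ∃! u : V ⟶ U, u ≫ ε' = a ∧ u ≫ ι' = b := by
  have hco : ∀ {X Z : C} {f : X ⟶ Z}, IsPreStep F f → IsCoAngularPreStep F f :=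
    fun h => isCoAngularPreStep_of_isotropic histr h
  intro V a b ha _ hab
  have hw : IsPreStep F (a ≫ ε) := IsPreStep.comp F ha hε
  have hdε : invDiv F ε hε.2 ∣ invDiv F (a ≫ ε) hw.2 := invDiv_dvd_invDiv_comp a ε hε hw.2
  have hdι : invDiv F ι hι.2 ∣ invDiv F (a ≫ ε) hw.2 := by
    have key : ∀ {χ : V ⟶ F'} (hχ : IsBaseIso F χ), χ = b ≫ ι → invDiv F ι hι.2 ∣ invDiv F χ hχ := by
      rintro χ hχ rfl
      exact invDiv_dvd_invDiv_comp b ι hι hχ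
    exact key hw.2 hab
  obtain ⟨u, -, hu⟩ := hF.iii_d_over_full (a ≫ ε) υ (hco hw) (hco hυ) (by rw [hx]; exact hsum _ hdε hdι)
  haveI := hF.v_a ε hε
  haveI := hF.v_a ι hι
  haveI := hF.v_a ε' hε'
  have hua : u ≫ ε' = a := by
    apply (cancel_mono ε).mp
    rw [Category.assoc, hε'e, hu]
  have hub : u ≫ ι' = b := by
    apply (cancel_mono ι).mp
    rw [Category.assoc, hι'e, hu, hab]
  exact ⟨u, ⟨hua, hub⟩, fun u' hu' => (cancel_mono ε').mp (by rw [hu'.1, hua])⟩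


end PreFrobenioid

end Literature.AlgebraicGeometry.Frobenioids
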